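import Mathlib
import Summits.Ventures.PercRepro2.Defs
import Summits.Ventures.PercRepro2.Independence
import Summits.Ventures.PercRepro2.Harris
import Summits.Ventures.PercRepro2.Graph
import Summits.Ventures.PercRepro2.Exploration
import Summits.Ventures.PercRepro2.Events
import Summits.Ventures.PercRepro2.Induced
import Summits.Ventures.PercRepro2.SeedSet
import Summits.Ventures.PercRepro2.MultiSourceFun
import Summits.Ventures.PercRepro2.CrossRootT
import Summits.Ventures.PercRepro2.RBDefs
import Summits.Ventures.PercRepro2.RBChain

/-!
# The transport: row 2′RB on the hole graph gives the per-atom Rao–Blackwell step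
(blind cell PercRepro2, typer-1; mine-a g3/g4 proofs/MINEA-RBBHK.md §8 "THE TRANSPORT", lead g12
ASSIGNMENTS v11.14 typer (4))

Revealing the clusters of `W` leaves a state `x = (A_w)_{w ∈ W}`; on the atom `{state = x}` the union
`H(x) = ⋃_w A_w` is `clusterSet W` and every edge at `H(x)` is determined (FACT 1: the atom depends on
`touches H(x)`, `dependsOn_atom`), while for `u ∉ H(x)` the cluster of `u` is its cluster in
`G − H(x)` (FACT 2: `cluster_delConfig_clusterSet`, `cluster_eq_del_of_atom`). With the pinned
weights `pinSet p H(x)` (`p′ = p · 1_{E′}`: the weight vector with the edges at `H(x)` closed — the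
residual graph on the SAME `(V, E)`), `P_{p′}(F) = P_p({ω | delConfig H ω ∈ F})` (`prob_pinSet_eq`,
the glue decomposition), and the `E′`-events are independent of the atom
(`prob_atom_inter_del`). Hence on a HOLE atom (`s, t, b, o, w′ ∉ H(x)`) every mass of the atom
inequality is `P(atom) · P_{p′}(·)`, the common factor cancels, and the per-atom (RB-cross) step for
`C(w′)` is exactly `RBcross p′ ends o b s t w′`:

* **`atom_step_of_RBcross`** (the hole transport): `RBcross (pinSet p H(x)) ends o b s t w′ →`
  the atom inequality of `RBcrossOn (revealState W) (C(w′))` at `x`, whenever `s, t, b, o, w′ ∉ H(x)`.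

The 0-step atoms (a root, a marker or `w′` inside `H(x)`) are equalities (mine-a §8) and are the
other half of `RBcrossOn … ⟸ RB_all`; they are not in this file.
-/

namespace Summit.Ventures.PercRepro2

namespace RB

open scoped Classical

variable {V : Type*} {E : Type*} [Fintype E] [DecidableEq E] [Fintype V] [DecidableEq V]
  {R : Type*} [Field R] [LinearOrder R] [IsStrictOrderedRing R]

/-! ## Pinned weights on a vertex set -/

section Pin

variable (p : E → R) (ends : E → Sym2 V) (H : Set V)

/-- The weights with every edge at `H` closed: `p′ = p · 1_{E′}`. -/
noncomputable def pinSet : E → R := fun e => if e ∈ touches ends H then 0 else p e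

omit [Fintype E] [DecidableEq E] [LinearOrder R] [IsStrictOrderedRing R] in
/-- `pinSet` on an edge at `H`. -/
lemma pinSet_of_mem {e : E} (h : e ∈ touches ends H) : pinSet p ends H e = 0 := by
  simp [pinSet, h]

omit [Fintype E] [DecidableEq E] [LinearOrder R] [IsStrictOrderedRing R] in
/-- `pinSet` on an edge not at `H`. -/
lemma pinSet_of_notMem {e : E} (h : e ∉ touches ends H) : pinSet p ends H e = p e := by
  simp [pinSet, h]

omit [Fintype E] [DecidableEq E] in
/-- The pinned weights are admissible. -/
lemma isProbVec_pinSet (hp : IsProbVec p) : IsProbVec (pinSet p ends H) := by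
  refine ⟨fun e => ?_, fun e => ?_⟩
  · unfold pinSet; split_ifs
    · exact le_rfl
    · exact hp.nonneg e
  · unfold pinSet; split_ifs
    · exact zero_le_one
    · exact hp.le_one e

omit [Fintype E] [DecidableEq E] in
/-- `delConfig` of a glued configuration closes the `H`-part. -/
lemma delConfig_glue_set (σ₁ : {e // e ∈ touches ends H} → Bool)
    (σ₂ : {e // e ∉ touches ends H} → Bool) :
    delConfig ends H (glue (touches ends H) σ₁ σ₂) = glue (touches ends H) (fun _ => false) σ₂ := by
  funext e
  by_cases h : e ∈ touches ends H
  · rw [delConfig_apply_of_mem h, glue_apply_of_mem _ _ _ h]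
  · rw [delConfig_apply_of_notMem h, glue_apply_of_notMem _ _ _ h, glue_apply_of_notMem _ _ _ h]

omit [DecidableEq E] [LinearOrder R] [IsStrictOrderedRing R] in
/-- The pinned weight of the `H`-part is the indicator of "every edge at `H` closed". -/
lemma weight_pinSet_part (σ₁ : {e // e ∈ touches ends H} → Bool) :
    weight (fun i : {e // e ∈ touches ends H} => pinSet p ends H i) σ₁ =
      if σ₁ = fun _ => false then 1 else 0 := by
  unfold weight
  split_ifs with h
  · subst h
    refine Finset.prod_eq_one fun i _ => ?_
    simp only [pinSet_of_mem p ends H i.2]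
    simp
  · obtain ⟨i, hi⟩ : ∃ i, σ₁ i = true := by
      by_contra hc
      apply h
      funext i
      cases hσ : σ₁ i with
      | false => rfl
      | true => exact absurd ⟨i, hσ⟩ hc
    refine Finset.prod_eq_zero (Finset.mem_univ i) ?_
    simp only [pinSet_of_mem p ends H i.2, hi]
    simp

omit [DecidableEq E] [LinearOrder R] [IsStrictOrderedRing R] in
/-- Off `H` the pinned weights are the original ones. -/
lemma weight_pinSet_rest (σ₂ : {e // e ∉ touches ends H} → Bool) :
    weight (fun i : {e // e ∉ touches ends H} => pinSet p ends H i) σ₂ =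
      weight (fun i : {e // e ∉ touches ends H} => p i) σ₂ := by
  unfold weight
  refine Finset.prod_congr rfl fun i _ => ?_
  simp only [pinSet_of_notMem p ends H i.2]

omit [LinearOrder R] [IsStrictOrderedRing R] in
/-- **The pinning identity**: `P_{p′}(F) = P_p({ω | delConfig H ω ∈ F})`. -/
theorem prob_pinSet_eq (F : Set (Config E)) :
    prob (pinSet p ends H) F = prob p {ω | delConfig ends H ω ∈ F} := by
  rw [prob_eq_expect_indicator, prob_eq_expect_indicator,
    expect_eq_sum_glue _ _ (touches ends H), expect_eq_sum_glue _ _ (touches ends H)]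
  have hR : ∀ σ₂ : {e // e ∉ touches ends H} → Bool,
      (∑ σ₁ : {e // e ∈ touches ends H} → Bool,
        weight (fun i : {e // e ∈ touches ends H} => p i) σ₁ *
          weight (fun i : {e // e ∉ touches ends H} => p i) σ₂ *
          ({ω | delConfig ends H ω ∈ F}).indicator 1 (glue (touches ends H) σ₁ σ₂)) =
      weight (fun i : {e // e ∉ touches ends H} => p i) σ₂ *
        F.indicator 1 (glue (touches ends H) (fun _ => false) σ₂) := by
    intro σ₂
    have hind : ∀ σ₁ : {e // e ∈ touches ends H} → Bool,
        ({ω | delConfig ends H ω ∈ F}).indicator (1 : Config E → R) (glue (touches ends H) σ₁ σ₂) =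
          F.indicator 1 (glue (touches ends H) (fun _ => false) σ₂) := by
      intro σ₁
      simp only [Set.indicator_apply, Set.mem_setOf_eq, delConfig_glue_set, Pi.one_apply]
    simp_rw [hind]
    rw [← Finset.sum_mul, ← Finset.sum_mul, sum_weight, one_mul]
  have hL : ∀ σ₂ : {e // e ∉ touches ends H} → Bool,
      (∑ σ₁ : {e // e ∈ touches ends H} → Bool,
        weight (fun i : {e // e ∈ touches ends H} => pinSet p ends H i) σ₁ *
          weight (fun i : {e // e ∉ touches ends H} => pinSet p ends H i) σ₂ *
          F.indicator 1 (glue (touches ends H) σ₁ σ₂)) =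
      weight (fun i : {e // e ∉ touches ends H} => p i) σ₂ *
        F.indicator 1 (glue (touches ends H) (fun _ => false) σ₂) := by
    intro σ₂
    rw [Finset.sum_eq_single (fun _ => false)]
    · rw [weight_pinSet_part, weight_pinSet_rest, if_pos rfl, one_mul]
    · intro σ₁ _ hne
      rw [weight_pinSet_part, if_neg hne, zero_mul, zero_mul]
    · intro h; exact absurd (Finset.mem_univ _) h
  rw [Finset.sum_comm]
  conv_rhs => rw [Finset.sum_comm]
  refine Finset.sum_congr rfl fun σ₂ _ => ?_
  rw [hL σ₂, hR σ₂]

omit [Fintype E] [DecidableEq E] in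
/-- Events of `G − H` depend on the edges off `H`. -/
lemma dependsOn_del (F : Set (Config E)) :
    DependsOn (· ∈ {ω | delConfig ends H ω ∈ F}) (touches ends H)ᶜ := by
  intro ω ω' h
  simp only [Set.mem_setOf_eq]
  have : delConfig ends H ω = delConfig ends H ω' := by
    funext e
    by_cases he : e ∈ touches ends H
    · rw [delConfig_apply_of_mem he, delConfig_apply_of_mem he]
    · rw [delConfig_apply_of_notMem he, delConfig_apply_of_notMem he]
      exact h e he
  rw [this]

end Pin

/-! ## An algebraic identity -/

section Alg

variable {R : Type*} [Field R]

/-- `(a u)(a v) / (a w) = a (u v / w)` in a field (also when `a = 0` or `w = 0`). -/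
lemma mul_mul_div_mul (a u v w : R) : a * u * (a * v) / (a * w) = a * (u * v / w) := by
  by_cases ha : a = 0
  · subst ha; simp
  · by_cases hw : w = 0
    · subst hw; simp
    · field_simp

end Alg

/-! ## Atoms of the revealment and the holes -/

section Atom

variable (ends : E → Sym2 V) (W : Finset V)

/-- The union of the revealed clusters of a state `x`. -/
def revHull (x : ↥W → Set V) : Set V := ⋃ w : ↥W, x w

/-- The atom `{state = x}`. -/
def atom (x : ↥W → Set V) : Set (Config E) := {ω | revealState ends W ω = x}

omit [Fintype E] [DecidableEq E] [Fintype V] [DecidableEq V] in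
/-- On the atom, `H(x) = clusterSet W`. -/
lemma clusterSet_eq_hull_of_atom {x : ↥W → Set V} {ω : Config E} (hω : ω ∈ atom ends W x) :
    clusterSet ends ω W = revHull W x := by
  ext v
  simp only [mem_clusterSet, revHull, Set.mem_iUnion]
  constructor
  · rintro ⟨w, hw, hc⟩
    refine ⟨⟨w, hw⟩, ?_⟩
    have := congrFun hω ⟨w, hw⟩
    simp only [revealState] at this
    rw [← this]
    exact hc
  · rintro ⟨⟨w, hw⟩, hv⟩
    have := congrFun hω ⟨w, hw⟩
    simp only [revealState] at this
    rw [← this] at hv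
    exact ⟨w, hw, hv⟩

omit [Fintype E] [DecidableEq E] [Fintype V] [DecidableEq V] in
/-- **FACT 1**: the atom depends on the edges at `H(x)`. -/
lemma dependsOn_atom (x : ↥W → Set V) :
    DependsOn (· ∈ atom ends W x) (touches ends (revHull W x)) := by
  intro ω ω' h
  have key : ∀ {ω ω' : Config E}, (∀ e ∈ touches ends (revHull W x), ω e = ω' e) →
      ω ∈ atom ends W x → ω' ∈ atom ends W x := by
    intro ω ω' h hω
    funext w
    have hw := congrFun hω w
    simp only [revealState] at hw ⊢
    refine cluster_eq_of_eqOn_touches (fun e he => h e ?_) hw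
    obtain ⟨u, hu, v, huv⟩ := he
    exact ⟨u, Set.mem_iUnion.2 ⟨w, hu⟩, v, huv⟩
  exact propext ⟨key h, key fun e he => (h e he).symm⟩

omit [Fintype E] [DecidableEq E] [Fintype V] [DecidableEq V] in
/-- **FACT 2**: on the atom, the cluster of a vertex outside `H(x)` is its cluster in `G − H(x)`. -/
lemma cluster_eq_del_of_atom {x : ↥W → Set V} {ω : Config E} (hω : ω ∈ atom ends W x) {u : V}
    (hu : u ∉ revHull W x) :
    cluster ends (delConfig ends (revHull W x) ω) u = cluster ends ω u := by
  rw [← clusterSet_eq_hull_of_atom ends W hω]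
  exact cluster_delConfig_clusterSet (by rwa [clusterSet_eq_hull_of_atom ends W hω])

omit [Fintype E] [DecidableEq E] [Fintype V] [DecidableEq V] in
/-- Connections between vertices outside `H(x)` are connections of `G − H(x)` on the atom. -/
lemma conn_iff_del_of_atom {x : ↥W → Set V} {ω : Config E} (hω : ω ∈ atom ends W x) {u v : V}
    (hu : u ∉ revHull W x) :
    Conn ends ω u v ↔ Conn ends (delConfig ends (revHull W x) ω) u v := by
  rw [← mem_cluster, ← mem_cluster, cluster_eq_del_of_atom ends W hω hu]

variable (p : E → R)

omit [LinearOrder R] [IsStrictOrderedRing R] in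
/-- **Independence of the atom and the `E′`-events**. -/
lemma prob_atom_inter_del (x : ↥W → Set V) (F : Set (Config E)) :
    prob p (atom ends W x ∩ {ω | delConfig ends (revHull W x) ω ∈ F}) =
      prob p (atom ends W x) * prob (pinSet p ends (revHull W x)) F := by
  rw [prob_pinSet_eq]
  exact prob_inter_eq_mul_of_dependsOn p (F₁ := touches ends (revHull W x))
    (F₂ := (touches ends (revHull W x))ᶜ) disjoint_compl_right (dependsOn_atom ends W x)
    (dependsOn_del ends (revHull W x) F)

end Atom

/-! ## The hole transport -/

section Hole

variable (p : E → R) (ends : E → Sym2 V) (W : Finset V) (o b s t w' : V) (x : ↥W → Set V)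

omit [Fintype E] [DecidableEq E] [Fintype V] [DecidableEq V] in
/-- On a hole atom the `E′`-versions of `Q`, `X`, `Y`, `{C(w′) = y}` agree with the originals. -/
lemma hole_event_eq (hs : s ∉ revHull W x) (hb : b ∉ revHull W x)
    (ho : o ∉ revHull W x) (hw : w' ∉ revHull W x) (y : Set V) :
    (Qst ends s t ∩ atom ends W x ∩ {ω | cluster ends ω w' = y} ∩ connEvent ends b s =
        atom ends W x ∩ {ω | delConfig ends (revHull W x) ω ∈
          Qst ends s t ∩ {ω | cluster ends ω w' = y} ∩ connEvent ends b s}) ∧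
      (Qst ends s t ∩ atom ends W x ∩ {ω | cluster ends ω w' = y} ∩ connEvent ends o t =
        atom ends W x ∩ {ω | delConfig ends (revHull W x) ω ∈
          Qst ends s t ∩ {ω | cluster ends ω w' = y} ∩ connEvent ends o t}) ∧
      (Qst ends s t ∩ atom ends W x ∩ {ω | cluster ends ω w' = y} =
        atom ends W x ∩ {ω | delConfig ends (revHull W x) ω ∈
          Qst ends s t ∩ {ω | cluster ends ω w' = y}}) ∧
      (Qst ends s t ∩ atom ends W x ∩ connEvent ends b s =
        atom ends W x ∩ {ω | delConfig ends (revHull W x) ω ∈ Qst ends s t ∩ connEvent ends b s}) ∧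
      (Qst ends s t ∩ atom ends W x ∩ connEvent ends o t =
        atom ends W x ∩ {ω | delConfig ends (revHull W x) ω ∈ Qst ends s t ∩ connEvent ends o t}) ∧
      (Qst ends s t ∩ atom ends W x =
        atom ends W x ∩ {ω | delConfig ends (revHull W x) ω ∈ Qst ends s t}) := by
  have hQ : ∀ ω ∈ atom ends W x, (ω ∈ Qst ends s t ↔ delConfig ends (revHull W x) ω ∈ Qst ends s t) := by
    intro ω hω
    simp only [Qst, connEvent, Set.mem_compl_iff, Set.mem_setOf_eq]
    rw [conn_iff_del_of_atom ends W hω hs]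
  have hX : ∀ ω ∈ atom ends W x,
      (ω ∈ connEvent ends b s ↔ delConfig ends (revHull W x) ω ∈ connEvent ends b s) := by
    intro ω hω
    simp only [connEvent, Set.mem_setOf_eq]
    rw [conn_iff_del_of_atom ends W hω hb]
  have hY : ∀ ω ∈ atom ends W x,
      (ω ∈ connEvent ends o t ↔ delConfig ends (revHull W x) ω ∈ connEvent ends o t) := by
    intro ω hω
    simp only [connEvent, Set.mem_setOf_eq]
    rw [conn_iff_del_of_atom ends W hω ho]
  have hC : ∀ ω ∈ atom ends W x, (ω ∈ {ω | cluster ends ω w' = y} ↔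
      delConfig ends (revHull W x) ω ∈ {ω | cluster ends ω w' = y}) := by
    intro ω hω
    simp only [Set.mem_setOf_eq]
    rw [cluster_eq_del_of_atom ends W hω hw]
  refine ⟨?_, ?_, ?_, ?_, ?_, ?_⟩ <;> ext ω <;>
    simp only [Set.mem_inter_iff, Set.mem_setOf_eq] <;>
    constructor
  · rintro ⟨⟨⟨hq, hA⟩, hc⟩, hx⟩
    exact ⟨hA, ⟨(hQ ω hA).1 hq, (hC ω hA).1 hc⟩, (hX ω hA).1 hx⟩
  · rintro ⟨hA, ⟨hq, hc⟩, hx⟩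
    exact ⟨⟨⟨(hQ ω hA).2 hq, hA⟩, (hC ω hA).2 hc⟩, (hX ω hA).2 hx⟩
  · rintro ⟨⟨⟨hq, hA⟩, hc⟩, hy⟩
    exact ⟨hA, ⟨(hQ ω hA).1 hq, (hC ω hA).1 hc⟩, (hY ω hA).1 hy⟩
  · rintro ⟨hA, ⟨hq, hc⟩, hy⟩
    exact ⟨⟨⟨(hQ ω hA).2 hq, hA⟩, (hC ω hA).2 hc⟩, (hY ω hA).2 hy⟩
  · rintro ⟨⟨hq, hA⟩, hc⟩
    exact ⟨hA, (hQ ω hA).1 hq, (hC ω hA).1 hc⟩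
  · rintro ⟨hA, hq, hc⟩
    exact ⟨⟨(hQ ω hA).2 hq, hA⟩, (hC ω hA).2 hc⟩
  · rintro ⟨⟨hq, hA⟩, hx⟩
    exact ⟨hA, (hQ ω hA).1 hq, (hX ω hA).1 hx⟩
  · rintro ⟨hA, hq, hx⟩
    exact ⟨⟨(hQ ω hA).2 hq, hA⟩, (hX ω hA).2 hx⟩
  · rintro ⟨⟨hq, hA⟩, hy⟩
    exact ⟨hA, (hQ ω hA).1 hq, (hY ω hA).1 hy⟩
  · rintro ⟨hA, hq, hy⟩
    exact ⟨⟨(hQ ω hA).2 hq, hA⟩, (hY ω hA).2 hy⟩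
  · rintro ⟨hq, hA⟩
    exact ⟨hA, (hQ ω hA).1 hq⟩
  · rintro ⟨hA, hq⟩
    exact ⟨(hQ ω hA).2 hq, hA⟩

/-- **The hole transport** (mine-a §8): on an atom `x` with `s, t, b, o, w′ ∉ H(x)`, the atom
inequality of `RBcrossOn (revealState W) (C(w′))` follows from `RBcross` at the pinned weights
`pinSet p H(x)` (row 2′RB on the residual graph). -/
theorem atom_step_of_RBcross (hp : IsProbVec p) (hs : s ∉ revHull W x)
    (hb : b ∉ revHull W x) (ho : o ∉ revHull W x) (hw : w' ∉ revHull W x)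
    (hRB : RBcross (pinSet p ends (revHull W x)) ends o b s t w') :
    (∑ y : Set V, prob p (Qst ends s t ∩ {ω | revealState ends W ω = x} ∩
          {ω | cluster ends ω w' = y} ∩ connEvent ends b s) *
        prob p (Qst ends s t ∩ {ω | revealState ends W ω = x} ∩ {ω | cluster ends ω w' = y} ∩
          connEvent ends o t) /
      prob p (Qst ends s t ∩ {ω | revealState ends W ω = x} ∩ {ω | cluster ends ω w' = y})) ≤
    prob p (Qst ends s t ∩ {ω | revealState ends W ω = x} ∩ connEvent ends b s) *
        prob p (Qst ends s t ∩ {ω | revealState ends W ω = x} ∩ connEvent ends o t) /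
      prob p (Qst ends s t ∩ {ω | revealState ends W ω = x}) := by
  have hA0 : 0 ≤ prob p (atom ends W x) := prob_nonneg hp _
  set q := pinSet p ends (revHull W x) with hq
  set pa := prob p (atom ends W x) with hpa
  -- every mass is `P(atom) · P_q(·)`
  have hterm : ∀ y : Set V,
      prob p (Qst ends s t ∩ {ω | revealState ends W ω = x} ∩ {ω | cluster ends ω w' = y} ∩
          connEvent ends b s) *
        prob p (Qst ends s t ∩ {ω | revealState ends W ω = x} ∩ {ω | cluster ends ω w' = y} ∩
          connEvent ends o t) /
      prob p (Qst ends s t ∩ {ω | revealState ends W ω = x} ∩ {ω | cluster ends ω w' = y}) =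
      pa * (prob q (Qst ends s t ∩ {ω | cluster ends ω w' = y} ∩ connEvent ends b s) *
        prob q (Qst ends s t ∩ {ω | cluster ends ω w' = y} ∩ connEvent ends o t) /
        prob q (Qst ends s t ∩ {ω | cluster ends ω w' = y})) := by
    intro y
    obtain ⟨e1, e2, e3, -, -, -⟩ := hole_event_eq ends W o b s t w' x hs hb ho hw y
    show prob p (Qst ends s t ∩ atom ends W x ∩ {ω | cluster ends ω w' = y} ∩ connEvent ends b s) *
        prob p (Qst ends s t ∩ atom ends W x ∩ {ω | cluster ends ω w' = y} ∩ connEvent ends o t) /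
      prob p (Qst ends s t ∩ atom ends W x ∩ {ω | cluster ends ω w' = y}) = _
    rw [e1, e2, e3, prob_atom_inter_del, prob_atom_inter_del, prob_atom_inter_del]
    exact mul_mul_div_mul pa _ _ _
  obtain ⟨-, -, -, e4, e5, e6⟩ := hole_event_eq ends W o b s t w' x hs hb ho hw ∅
  have hrhs : prob p (Qst ends s t ∩ {ω | revealState ends W ω = x} ∩ connEvent ends b s) *
        prob p (Qst ends s t ∩ {ω | revealState ends W ω = x} ∩ connEvent ends o t) /
      prob p (Qst ends s t ∩ {ω | revealState ends W ω = x}) =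
      pa * (prob q (Qst ends s t ∩ connEvent ends b s) * prob q (Qst ends s t ∩ connEvent ends o t) /
        prob q (Qst ends s t)) := by
    show prob p (Qst ends s t ∩ atom ends W x ∩ connEvent ends b s) *
        prob p (Qst ends s t ∩ atom ends W x ∩ connEvent ends o t) /
      prob p (Qst ends s t ∩ atom ends W x) = _
    rw [e4, e5, e6, prob_atom_inter_del, prob_atom_inter_del, prob_atom_inter_del]
    exact mul_mul_div_mul pa _ _ _
  simp_rw [hterm]
  rw [hrhs, ← Finset.mul_sum]
  exact mul_le_mul_of_nonneg_left hRB hA0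

end Hole

end RB

end Summit.Ventures.PercRepro2
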